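import Mathlib
import Summits.Ventures.DiscreteObjects.Mahler.SymmetricRootIntegrality
import Summits.Ventures.DiscreteObjects.Mahler.PisotLowerBound
import Summits.Ventures.DiscreteObjects.Mahler.SmallMeasureCensus

/-!
# Separation of root powers for nondegenerate polynomials; integrality of the cross product (venture `DiscreteObjects`, target L)

Cell `pub-namedobj`, seat `pub-namedobj-mahler-g27`. Framing: lottery ticket; floor = certified bounds/negative ranges.

Two bricks for the Cantor–Straus proof of Dobrowolski's theorem [cite: MckeeSmyth2021, Theorem 3.1, §3.2]:
* `root_pow_ne_root_pow` — for `f ∈ ℤ[X]` monic, irreducible, with `M(f) > 1` and NONDEGENERATE (no two distinct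
  complex roots have a common positive power), and complex roots `a, b`: `a^p ≠ b^{p'}` whenever `0 < p ≠ p'`.
  (Folklore; the printed proof obtains it from Lemma 3.8.  Kernel proof: the `p`-th powers of the `d` roots are `d`
  distinct roots of `minpoly_ℚ(a^p)`, whose degree is `≤ d` as `a^p ∈ ℚ(a)`; so they are ALL its complex roots, and so
  are the `p'`-th powers; comparing the largest modulus `h > 1` of a root (the house; `M(f) > 1`) gives `h^p = h^{p'}`.)
* `one_le_norm_prod_pow_sub_pow_pairs` — for the roots `α_i` of a monic `f ∈ ℤ[X]` and exponents `q_j`, the cross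
  product `∏_{(i,j) ≠ (i',j')} (α_i^{q_j} - α_{i'}^{q_{j'}})` is a rational integer (a symmetric integer polynomial in
  the roots, `SymmetricRootIntegrality`), hence of modulus `≥ 1` when nonzero [cite: MckeeSmyth2021, §3.2, "the
  symmetric function … is at least 1"].
REPLICATION, no new mathematics.
-/

namespace Summit.Ventures.DiscreteObjects.Mahler

open Polynomial Finset

/-- A monic integer polynomial with `M(f) > 1` has positive degree. -/
theorem natDegree_pos_of_one_lt_measure {f : ℤ[X]} (hmon : f.Monic) (hM : 1 < intMahlerMeasure f) :
    0 < f.natDegree := by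
  by_contra hd
  push Not at hd
  have hf1 : f = 1 := by
    rw [eq_C_of_natDegree_eq_zero (Nat.le_zero.1 hd)]
    have h := hmon.leadingCoeff
    rw [leadingCoeff, Nat.le_zero.1 hd] at h
    rw [h, C_1]
  rw [hf1] at hM
  have : intMahlerMeasure (1 : ℤ[X]) = 1 := by
    unfold intMahlerMeasure
    simp
  linarith

/-- A monic integer polynomial with `M(f) > 1` has a complex root of modulus `> 1` dominating all roots (the house). -/
theorem exists_root_norm_gt_one {f : ℤ[X]} (hmon : f.Monic) (hM : 1 < intMahlerMeasure f) :
    ∃ x ∈ (f.map (Int.castRingHom ℂ)).roots, 1 < ‖x‖ ∧ ∀ y ∈ (f.map (Int.castRingHom ℂ)).roots, ‖y‖ ≤ ‖x‖ := by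
  classical
  set RC := (f.map (Int.castRingHom ℂ)).roots with hRC
  have hMf : intMahlerMeasure f = (RC.map fun γ => max 1 ‖γ‖).prod := by
    unfold intMahlerMeasure
    rw [mahlerMeasure_eq_leadingCoeff_mul_prod_roots, (hmon.map (Int.castRingHom ℂ)).leadingCoeff, norm_one,
      one_mul]
  have hex : ∃ x ∈ RC, 1 < ‖x‖ := by
    by_contra h
    push Not at h
    have : (RC.map fun γ => max 1 ‖γ‖).prod = 1 :=
      Multiset.prod_eq_one fun a ha => by
        obtain ⟨γ, hγ, rfl⟩ := Multiset.mem_map.1 ha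
        exact max_eq_left (h γ hγ)
    rw [hMf, this] at hM
    exact lt_irrefl _ hM
  obtain ⟨x, hx, hx1⟩ := hex
  have hne : RC.toFinset.Nonempty := ⟨x, Multiset.mem_toFinset.2 hx⟩
  obtain ⟨x₀, hx₀, hmax⟩ := Finset.exists_max_image RC.toFinset (fun y => ‖y‖) hne
  refine ⟨x₀, Multiset.mem_toFinset.1 hx₀, lt_of_lt_of_le hx1 (hmax x (Multiset.mem_toFinset.2 hx)),
    fun y hy => hmax y (Multiset.mem_toFinset.2 hy)⟩

/-- **Separation of powers of the roots.**  Let `f ∈ ℤ[X]` be monic, irreducible, nondegenerate with `M(f) > 1`.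
Then for complex roots `a, b` of `f` and positive integers `p ≠ p'`: `a^p ≠ b^{p'}`.  (The `p`-th powers of the
`d` roots are `d` distinct roots of `minpoly_ℚ(a^p)`, which has degree `≤ d`; so they are ALL its roots, and likewise
for the `p'`-th powers; comparing the largest modulus `h > 1` gives `h^p = h^{p'}`.) -/
theorem root_pow_ne_root_pow {f : ℤ[X]} (hmon : f.Monic) (hirr : Irreducible f) (hM : 1 < intMahlerMeasure f)
    (hnd : ∀ a ∈ (f.map (Int.castRingHom ℂ)).roots, ∀ b ∈ (f.map (Int.castRingHom ℂ)).roots, a ≠ b →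
      ∀ n : ℕ, 0 < n → a ^ n ≠ b ^ n)
    {a b : ℂ} (ha : a ∈ (f.map (Int.castRingHom ℂ)).roots)
    (hb : b ∈ (f.map (Int.castRingHom ℂ)).roots) {p p' : ℕ} (hp : 0 < p) (hp' : 0 < p') (hpp' : p ≠ p') :
    a ^ p ≠ b ^ p' := by
  classical
  intro hab
  set RC := (f.map (Int.castRingHom ℂ)).roots with hRC
  have hdeg : 0 < f.natDegree := natDegree_pos_of_one_lt_measure hmon hM
  have hfC0 : f.map (Int.castRingHom ℂ) ≠ 0 := (hmon.map _).ne_zero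
  have hrootiff : ∀ γ : ℂ, γ ∈ RC ↔ aeval γ f = 0 := by
    intro γ
    rw [hRC, mem_roots hfC0, IsRoot.def, ← algebraMap_int_eq, eval_map_algebraMap]
  -- the minimal polynomial of every root is `f`
  have hfQ : Irreducible (f.map (algebraMap ℤ ℚ)) :=
    ((hirr.isPrimitive hdeg.ne').irreducible_iff_irreducible_map_fraction_map (K := ℚ)).mp hirr
  have hmin : ∀ x ∈ RC, minpoly ℚ x = f.map (algebraMap ℤ ℚ) := by
    intro x hx
    refine (minpoly.eq_of_irreducible_of_monic hfQ ?_ (hmon.map _)).symm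
    rw [aeval_map_algebraMap]
    exact (hrootiff x).1 hx
  have hint : ∀ x ∈ RC, IsIntegral ℚ x := by
    intro x hx
    refine ⟨f.map (algebraMap ℤ ℚ), hmon.map _, ?_⟩
    rw [← aeval_def, aeval_map_algebraMap]
    exact (hrootiff x).1 hx
  -- `Z` = complex roots of `m = minpoly_ℚ(γ)`, `γ = a^p`
  set γ : ℂ := a ^ p with hγ
  set m : ℚ[X] := minpoly ℚ γ with hm
  have hγint : IsIntegral ℚ γ := (hint a ha).pow p
  have hm0 : m ≠ 0 := minpoly.ne_zero hγint
  set Z : Finset ℂ := ((m.map (algebraMap ℚ ℂ)).roots).toFinset with hZ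
  have hmemZ : ∀ z : ℂ, z ∈ Z ↔ aeval z m = 0 := by
    intro z
    rw [hZ, Multiset.mem_toFinset, mem_roots_map_of_injective (algebraMap ℚ ℂ).injective hm0, ← aeval_def]
  -- `deg m ≤ d`
  have hmdeg : m.natDegree ≤ f.natDegree := by
    have haint := hint a ha
    haveI := IntermediateField.adjoin.finiteDimensional haint
    have hγmem : γ ∈ IntermediateField.adjoin ℚ {a} :=
      pow_mem (IntermediateField.mem_adjoin_simple_self ℚ a) p
    have h1 := minpoly.natDegree_le (A := ℚ) (⟨γ, hγmem⟩ : IntermediateField.adjoin ℚ {a})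
    rw [IntermediateField.adjoin.finrank haint] at h1
    have h2 := IntermediateField.minpoly_eq (K := ℚ) (⟨γ, hγmem⟩ : IntermediateField.adjoin ℚ {a})
    erw [h2] at h1
    have h3 : (minpoly ℚ a).natDegree = f.natDegree := by
      rw [hmin a ha, natDegree_map_eq_of_injective (algebraMap ℤ ℚ).injective_int]
    rw [← h3]
    exact h1
  have hZcard : Z.card ≤ f.natDegree := by
    refine (Multiset.toFinset_card_le _).trans ((card_roots' _).trans ?_)
    rw [natDegree_map]
    exact hmdeg
  -- every `k`-th power of a root lies in `Z` as soon as one does (`c^k = γ`)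
  have hincl : ∀ c ∈ RC, ∀ k : ℕ, c ^ k = γ → ∀ x ∈ RC, x ^ k ∈ Z := by
    intro c hc k hck x hx
    have hdvd : minpoly ℚ c ∣ m.comp (X ^ k) := by
      apply minpoly.dvd
      rw [aeval_comp, aeval_X_pow, hck]
      exact minpoly.aeval ℚ γ
    obtain ⟨r, hr⟩ := hdvd
    have hxc : aeval x (minpoly ℚ c) = 0 := by
      rw [hmin c hc, aeval_map_algebraMap]
      exact (hrootiff x).1 hx
    have h2 : aeval x (m.comp (X ^ k)) = 0 := by rw [hr, map_mul, hxc, zero_mul]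
    rw [aeval_comp, aeval_X_pow] at h2
    exact (hmemZ _).2 h2
  -- hence the `k`-th power map is ONTO `Z`
  have himg : ∀ c ∈ RC, ∀ k : ℕ, 0 < k → c ^ k = γ → RC.toFinset.image (fun x => x ^ k) = Z := by
    intro c hc k hk hck
    apply Finset.eq_of_subset_of_card_le
    · intro z hz
      obtain ⟨x, hx, rfl⟩ := Finset.mem_image.1 hz
      exact hincl c hc k hck x (Multiset.mem_toFinset.1 hx)
    · rw [Finset.card_image_of_injOn]
      · have hRCcard : RC.toFinset.card = f.natDegree := by
          rw [Multiset.card_toFinset, Multiset.dedup_eq_self.2 (nodup_roots_of_irreducible hirr hdeg),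
            splits_iff_card_roots.1 (IsAlgClosed.splits _),
            natDegree_map_eq_of_injective (Int.castRingHom ℂ).injective_int]
        rw [hRCcard]
        exact hZcard
      · intro x hx y hy hxy
        by_contra hne
        exact hnd x (Multiset.mem_toFinset.1 hx) y (Multiset.mem_toFinset.1 hy) hne k hk hxy
  have hZa : RC.toFinset.image (fun x => x ^ p) = Z := himg a ha p hp rfl
  have hZb : RC.toFinset.image (fun x => x ^ p') = Z := himg b hb p' hp' hab.symm
  -- the house
  obtain ⟨x₀, hx₀, hx₀1, hmax⟩ := exists_root_norm_gt_one hmon hM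
  have h1 : ‖x₀‖ ^ p' ≤ ‖x₀‖ ^ p := by
    have hmem : x₀ ^ p' ∈ Z := hZb ▸ Finset.mem_image_of_mem _ (Multiset.mem_toFinset.2 hx₀)
    rw [← hZa, Finset.mem_image] at hmem
    obtain ⟨x, hx, hxeq⟩ := hmem
    calc ‖x₀‖ ^ p' = ‖x₀ ^ p'‖ := (norm_pow _ _).symm
      _ = ‖x‖ ^ p := by rw [← hxeq, norm_pow]
      _ ≤ ‖x₀‖ ^ p := pow_le_pow_left₀ (norm_nonneg _) (hmax x (Multiset.mem_toFinset.1 hx)) _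
  have h2 : ‖x₀‖ ^ p ≤ ‖x₀‖ ^ p' := by
    have hmem : x₀ ^ p ∈ Z := hZa ▸ Finset.mem_image_of_mem _ (Multiset.mem_toFinset.2 hx₀)
    rw [← hZb, Finset.mem_image] at hmem
    obtain ⟨x, hx, hxeq⟩ := hmem
    calc ‖x₀‖ ^ p = ‖x₀ ^ p‖ := (norm_pow _ _).symm
      _ = ‖x‖ ^ p' := by rw [← hxeq, norm_pow]
      _ ≤ ‖x₀‖ ^ p' := pow_le_pow_left₀ (norm_nonneg _) (hmax x (Multiset.mem_toFinset.1 hx)) _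
  rcases Nat.lt_or_gt_of_ne hpp' with h | h
  · exact absurd (pow_lt_pow_right₀ hx₀1 h) (not_lt.2 h1)
  · exact absurd (pow_lt_pow_right₀ hx₀1 h) (not_lt.2 h2)

/-! ### The cross product `∏_{(i,j)≠(i',j')} (α_i^{q_j} - α_{i'}^{q_{j'}})` is an integer -/

/-- The polynomial `∏_{(i,j) ≠ (i',j')} (X_i^{q_j} - X_{i'}^{q_{j'}})` is symmetric in the `X_i`. -/
theorem isSymmetric_prod_pow_sub_pow_pairs {σ τ : Type*} [Fintype σ] [DecidableEq σ] [Fintype τ] [DecidableEq τ]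
    (q : τ → ℕ) :
    (∏ u : σ × τ, ∏ w ∈ univ.erase u,
      ((MvPolynomial.X u.1 : MvPolynomial σ ℤ) ^ q u.2 - MvPolynomial.X w.1 ^ q w.2)).IsSymmetric := by
  intro e
  simp only [map_prod, map_sub, map_pow, MvPolynomial.rename_X]
  set ee : σ × τ ≃ σ × τ := e.prodCongr (Equiv.refl τ) with hee
  have hinner : ∀ u : σ × τ, ∏ w ∈ univ.erase u,
      ((MvPolynomial.X (e u.1) : MvPolynomial σ ℤ) ^ q u.2 - MvPolynomial.X (e w.1) ^ q w.2) =
      ∏ w ∈ univ.erase (ee u),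
        ((MvPolynomial.X (ee u).1 : MvPolynomial σ ℤ) ^ q (ee u).2 - MvPolynomial.X w.1 ^ q w.2) := by
    intro u
    refine Finset.prod_equiv ee (fun w => ?_) (fun w _ => rfl)
    simp only [Finset.mem_erase, Finset.mem_univ, and_true]
    exact ee.injective.ne_iff.symm
  simp_rw [hinner]
  exact Fintype.prod_equiv ee _
    (fun u => ∏ w ∈ univ.erase u,
      ((MvPolynomial.X u.1 : MvPolynomial σ ℤ) ^ q u.2 - MvPolynomial.X w.1 ^ q w.2)) (fun u => rfl)

/-- **The cross product `∏_{(i,j) ≠ (i',j')} (α_i^{q_j} - α_{i'}^{q_{j'}})` over the roots of a monic integer polynomial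
is a rational integer**, hence has modulus `≥ 1` when it is nonzero. -/
theorem one_le_norm_prod_pow_sub_pow_pairs {σ τ : Type*} [Fintype σ] [DecidableEq σ] [Fintype τ] [DecidableEq τ]
    (f : ℤ[X]) (hmon : f.Monic) (α : σ → ℂ)
    (hα : (Finset.univ.val.map α : Multiset ℂ) = (f.map (Int.castRingHom ℂ)).roots) (q : τ → ℕ)
    (hne : ∏ u : σ × τ, ∏ w ∈ univ.erase u, (α u.1 ^ q u.2 - α w.1 ^ q w.2) ≠ 0) :
    1 ≤ ∏ u : σ × τ, ∏ w ∈ univ.erase u, ‖α u.1 ^ q u.2 - α w.1 ^ q w.2‖ := by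
  obtain ⟨z, hz⟩ := exists_int_eq_aeval_of_isSymmetric f hmon α hα _ (isSymmetric_prod_pow_sub_pow_pairs (σ := σ) q)
  simp only [map_prod, map_sub, map_pow, MvPolynomial.aeval_X] at hz
  have hz0 : z ≠ 0 := by
    rintro rfl
    rw [Int.cast_zero] at hz
    exact hne hz
  have h : ‖∏ u : σ × τ, ∏ w ∈ univ.erase u, (α u.1 ^ q u.2 - α w.1 ^ q w.2)‖ =
      ∏ u : σ × τ, ∏ w ∈ univ.erase u, ‖α u.1 ^ q u.2 - α w.1 ^ q w.2‖ := by
    rw [norm_prod]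
    exact Finset.prod_congr rfl fun u _ => norm_prod _ _
  rw [← h, hz, Complex.norm_intCast]
  exact_mod_cast Int.one_le_abs hz0

end Summit.Ventures.DiscreteObjects.Mahler
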